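import Summits.Ventures.CertifiedManyBodySolver.Theses.CovHg1201M19P10
import Summits.Ventures.CertifiedManyBodySolver.Downfold.BoxesHg1201EP10KinematicCoverN
import HarnessLib

/-!
# Theorems/CovHg1201M19P10KinematicParts.lean — route «CovHg1201M19P10» (@ 10 GPa, hubbard-cov-hg1201): the densities `n ≤ 43/50` of BOTH cruxes are
# certificate-free (state-free kinematics), and each crux follows from its high-density STRIP `n ∈ [43/50, 22/25]`

Supports stmt-Ventures-27104 «PatchLeftEdgeP10» and stmt-Ventures-27105 «PatchBottomP10» (captain RULING «n_k′ = 43/50 OF RECORD for the P10 patch», hubbard-obs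
STATUS 2026-08-28T09:00:42Z; the P = 0 twin is `Theorems/CovHg1201M19bKinematicParts`). With the `M = 512` kernel row `B(−49/100, 4301/8192) ≤ 0.2502620098` (reading `0.4760226 ≤ 0.4767609` at
`n = 43/50`) and the state-free orbit-lower family lemma (`Downfold.hg1201M19P10_patchSlot_orbitMean_ge_negBar`: every slot `σ ∈ [−49/100, −47/100]`, every
label, every source Hamiltonian, every density `x ∈ [21/25, 43/50]`), the bundles' inequality `−0.4767609 ≤ |D₄|⁻¹ Σ_γ Re ω_γ(−X₀(σ, ·))` holds with NO
ground-state certificate for `n ≤ 43/50` (`Downfold.hg1201M19P10_patchLeftEdgeP10_lowDensity_kinematic` / `…patchBottomP10…`, landed in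
`Downfold/BoxesHg1201EP10KinematicCoverN`); here only the reductions: each crux follows from its STRIP `n ∈ [43/50, 22/25]` (`…_of_highDensityStrip`). Seat hubbard-cov-hg1201-box-2 (`prover-hubbard-cov-hg1201-box-2-0`).
HONEST FRAMING: state-free one-body kinematics + set algebra; nothing interaction-sensitive is certified here; the cruxes stay OPEN on their strips;
certified stiffness CEILINGS on a downfolded box = CONTROL / CALIBRATION + labelled heuristic (xx1); not a `T_c`, phase or `dT_c/dP` statement.
-/

namespace Summit.Ventures.CertifiedManyBodySolver.Theorems

open Set Filter Topology
open Summit.Ventures.CertifiedManyBodySolver.Theses.CovHg1201M19P10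
open Summit.Ventures.CertifiedManyBodySolver.Observables
open Summit.Ventures.CertifiedManyBodySolver.Downfold
open Literature.MathematicalPhysics.QuantumLattice Literature.MathematicalPhysics.QuantumLattice.ThermodynamicLimit
open Literature.Probability.LatticeModels
open Matrix HubbardWave0
open scoped BigOperators ComplexOrder

/-- **«PatchLeftEdgeP10» from its high-density STRIP**: the item's statement restricted to `n ∈ [43/50, 22/25]` implies the item (the rest is the
state-free part above). CONDITIONAL on the strip. [cite: ScalapinoWhiteZhang1993, §II] [cite: HazraVermaRanderia2019, eqs. (2)-(6)] -/
theorem covHg1201M19P10_PatchLeftEdgeP10_of_highDensityStrip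
    (h : ∀ n ∈ Set.Icc (43 / 50 : ℝ) (22 / 25), ∀ σ ∈ Set.Icc (-49 / 100 : ℝ) (-47 / 100), ∀ U' ∈ Set.Icc (3 : ℝ) (17 / 2),
      ∀ (ω : InfVolFermionState 2) (Ls : ℕ → ℕ) (ψ : ∀ L, Fock (Orb (FermionTorus 2 L))),
      Tendsto Ls atTop atTop →
      (∀ j, IsGroundStateInSector (hubbardTorusTT' (Ls j) 1 (-49 / 100) U') (rectN n (Ls j)) 0 (ψ (Ls j))) →
      (∀ j, star (ψ (Ls j)) ⬝ᵥ ψ (Ls j) = 1) → ω.IsTorusLimitOf ψ Ls →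
      -(4767609 / 10000000 : ℝ) ≤ ((Finset.univ : Finset (DihedralGroup 4)).card : ℝ)⁻¹ * ∑ g ∈ (Finset.univ : Finset (DihedralGroup 4)),
        (ω.expect (d4ShiftSet g 0 (Literature.Probability.LatticeModels.box 2 7))
          (fermionEmbed (PolySite.d4Emb g 0 (Literature.Probability.LatticeModels.box 2 7)) (-oddMomentObsTT σ U' 0))).re) :
    PatchLeftEdgeP10 := by
  unfold PatchLeftEdgeP10
  intro n hn σ hσ U' hU' ω Ls ψ hLs hψ h1 hω
  rcases le_or_gt n (43 / 50) with hle | hgt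
  · exact hg1201M19P10_patchLeftEdgeP10_lowDensity_kinematic n ⟨hn.1, hle⟩ σ hσ U' hU' ω Ls ψ hLs hψ h1 hω
  · exact h n ⟨hgt.le, hn.2⟩ σ hσ U' hU' ω Ls ψ hLs hψ h1 hω

/-- **«PatchBottomP10» from its high-density STRIP** `n ∈ [43/50, 22/25]`. CONDITIONAL on the strip. [cite: ScalapinoWhiteZhang1993, §II] [cite: HazraVermaRanderia2019, eqs. (2)-(6)] -/
theorem covHg1201M19P10_PatchBottomP10_of_highDensityStrip
    (h : ∀ n ∈ Set.Icc (43 / 50 : ℝ) (22 / 25), ∀ σ ∈ Set.Icc (-49 / 100 : ℝ) (-47 / 100), ∀ s ∈ Set.Icc (-49 / 100 : ℝ) σ,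
      ∀ (ω : InfVolFermionState 2) (Ls : ℕ → ℕ) (ψ : ∀ L, Fock (Orb (FermionTorus 2 L))),
      Tendsto Ls atTop atTop →
      (∀ j, IsGroundStateInSector (hubbardTorusTT' (Ls j) 1 s 3) (rectN n (Ls j)) 0 (ψ (Ls j))) →
      (∀ j, star (ψ (Ls j)) ⬝ᵥ ψ (Ls j) = 1) → ω.IsTorusLimitOf ψ Ls →
      -(4767609 / 10000000 : ℝ) ≤ ((Finset.univ : Finset (DihedralGroup 4)).card : ℝ)⁻¹ * ∑ g ∈ (Finset.univ : Finset (DihedralGroup 4)),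
        (ω.expect (d4ShiftSet g 0 (Literature.Probability.LatticeModels.box 2 7))
          (fermionEmbed (PolySite.d4Emb g 0 (Literature.Probability.LatticeModels.box 2 7)) (-oddMomentObsTT σ 3 0))).re) :
    PatchBottomP10 := by
  unfold PatchBottomP10
  intro n hn σ hσ s hs ω Ls ψ hLs hψ h1 hω
  rcases le_or_gt n (43 / 50) with hle | hgt
  · exact hg1201M19P10_patchBottomP10_lowDensity_kinematic n ⟨hn.1, hle⟩ σ hσ s hs ω Ls ψ hLs hψ h1 hω
  · exact h n ⟨hgt.le, hn.2⟩ σ hσ s hs ω Ls ψ hLs hψ h1 hω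

end Summit.Ventures.CertifiedManyBodySolver.Theorems
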